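import Mathlib
import HarnessLib
import Literature.Probability.Percolation.MultiResTV
import Summits.CriticalPhenomena.CardyFormulaZ2.Theses.CardyGluingRDE

/-!
# `GluingContraction` follows from a power-law merging RATE, with `θ = 0`
(crux stmt-CriticalPhenomena-8580 of route CardyGluingRDE; lead's structural note, line `registered`)

Write `TV_j(u,u')` for the total variation between the bond-`ℤ²` (mesh `u`) and site-`𝕋` (mesh `u'`)
laws of the resolution-`j` segment-connectivity matrix of the square `(0,δ₀)²`, and
`Dw_K(u,u') = Σ_{j ≤ K} 2^{-σ j} TV_j(u,u')` (the route's inlined quantities).  The crux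
`GluingContraction` asks for `σ, κ, ρ, C > 0`, `θ ∈ [0,1)`, `m ≥ 1` with
(A) `Dw_K(u/2^m, u'/2^m) ≤ θ·Dw_K(u,u') + C·2^{-κK}` for `u ≤ δ₀/(C 2^K)`, `u' ≤ δ_T(δ₀,K)`,
`Dw_K(u,u') ≤ ρ`, and (B) an entry window on which `Dw_K ≤ ρ/2`.

This file records two elementary facts about the SHAPE of that statement (pure real analysis, no
percolation input), for the planners who re-line the crux:

* `GluingContraction_of_uniformRate` — the crux follows, with `θ = 0` and `m = 1`, from the
  UNIFORM RATE statement `Dw_K(u,u') ≤ C·2^{-κK}` for all `u ≤ δ₀/(C 2^K)`, `u' ≤ δ_T(δ₀,K)`: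
  clause (A) is then its own slack and clause (B) holds on the whole onset window with `ρ = 2C`.
  So the renormalisation content of the thesis (a `θ`-contraction of an explicit gluing map,
  shadowing) is not required by the statement itself: any proof of a power-law rate of merging
  closes it, and conversely the crux only returns plain merging (`ContractionGivesMerging`, landed).
* `GluingContraction_of_levelRate` — the uniform rate, hence the crux, follows from the familiar
  per-level form: a common limit vector `π_j` with a POWER-LAW rate on the `ℤ²` side,
  `TV(ℤ²-law_j at mesh u, π_j) ≤ A·2^{γ j}·(u/δ₀)^α` (`0 < u ≤ δ₀`), and mere convergence of the
  `𝕋` side, `TV(𝕋-law_j at mesh u', π_j) → 0` (`u' → 0`).  Constants: `σ = γ + α`, `κ = α`,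
  `C = max 1 ((A+1)(1 − 2^{-α})⁻¹)`.

Design (as in `ContractionGivesMerging`): the analysis is proved once for abstract kernels
(`GluingContractionOfRate.contraction_of_uniformRate`, `…uniformRate_of_levelRate`), and the route
statement is consumed by unification with its `let`-prelude.

References: Schramm–Smirnov 2011 (arXiv:1101.5820), Question 2 and Remark 5 (rates of convergence of
crossing probabilities); Langlands–Pouliot–Saint-Aubin (arXiv:math/9401222) §2 for the finite models.
-/

namespace Summit.CriticalPhenomena.CardyFormulaZ2.Theorems

namespace GluingContractionOfRate

open Literature.Probability.Percolation

/-- **`θ = 0` suffices.**  For an arbitrary kernel `Dw σ δ₀ K u u'`: if `Dw_K ≤ C·2^{-κK}` on the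
whole range `0 < u ≤ δ₀/(C 2^K)`, `0 < u' ≤ δ_T(δ₀,K)`, then the two clauses of `GluingContraction`
hold with `θ = 0`, `m = 1`, `ρ = 2C` and the same `σ, C, κ` (the conclusion is literally the body
of the route statement). [folklore] -/
theorem contraction_of_uniformRate {Dw : ℝ → ℝ → ℕ → ℝ → ℝ → ℝ}
    (h : ∃ σ C κ : ℝ, 0 < σ ∧ 0 < C ∧ 0 < κ ∧ ∀ δ₀ : ℝ, 0 < δ₀ → ∀ K : ℕ, ∃ δT : ℝ, 0 < δT ∧
      ∀ u u' : ℝ, 0 < u → u ≤ δ₀ / (C * 2 ^ K) → 0 < u' → u' ≤ δT →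
        Dw σ δ₀ K u u' ≤ C * (2 : ℝ) ^ (-(κ * (K : ℝ)))) :
    ∃ σ θ C κ ρ : ℝ, ∃ m : ℕ, 0 < σ ∧ 0 ≤ θ ∧ θ < 1 ∧ 0 < C ∧ 0 < κ ∧ 0 < ρ ∧ 1 ≤ m ∧
      ∀ δ₀ : ℝ, 0 < δ₀ → ∀ K : ℕ, ∃ δT : ℝ, 0 < δT ∧
        (∀ u u' : ℝ, 0 < u → u ≤ δ₀ / (C * 2 ^ K) → 0 < u' → u' ≤ δT →
          Dw σ δ₀ K u u' ≤ ρ →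
            Dw σ δ₀ K (u / 2 ^ m) (u' / 2 ^ m) ≤
              θ * Dw σ δ₀ K u u' + C * (2 : ℝ) ^ (-(κ * (K : ℝ)))) ∧
        (∃ uZ : ℝ, 0 < uZ ∧ uZ ≤ δ₀ / (C * 2 ^ K) ∧ ∀ u u' : ℝ, uZ / 2 ^ m ≤ u → u ≤ uZ →
          0 < u' → u' ≤ δT → Dw σ δ₀ K u u' ≤ ρ / 2) := by
  obtain ⟨σ, C, κ, hσ, hC, hκ, H⟩ := h
  refine ⟨σ, 0, C, κ, 2 * C, 1, hσ, le_rfl, one_pos, hC, hκ, by positivity, le_rfl,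
    fun δ₀ hδ₀ K => ?_⟩
  obtain ⟨δT, hδT, HK⟩ := H δ₀ hδ₀ K
  have hslack : (2 : ℝ) ^ (-(κ * (K : ℝ))) ≤ 1 :=
    Real.rpow_le_one_of_one_le_of_nonpos one_le_two
      (neg_nonpos.2 (mul_nonneg hκ.le (Nat.cast_nonneg K)))
  refine ⟨δT, hδT, ?_, δ₀ / (C * 2 ^ K), by positivity, le_rfl, ?_⟩
  · intro u u' hu hule hu' hu'le _
    have h2 : u / 2 ^ (1 : ℕ) ≤ δ₀ / (C * 2 ^ K) := (div_le_self hu.le (by norm_num)).trans hule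
    have h4 : u' / 2 ^ (1 : ℕ) ≤ δT := (div_le_self hu'.le (by norm_num)).trans hu'le
    have key := HK _ _ (by positivity) h2 (by positivity) h4
    rw [zero_mul, zero_add]
    exact key
  · intro u u' hu1 hu2 hu' hu'le
    have hu : 0 < u := lt_of_lt_of_le (by positivity) hu1
    calc Dw σ δ₀ K u u' ≤ C * (2 : ℝ) ^ (-(κ * (K : ℝ))) := HK u u' hu hu2 hu' hu'le
      _ ≤ C * 1 := by gcongr
      _ = 2 * C / 2 := by ring

/-- A common onset for finitely many levels: if for every level `j` and accuracy `ε` the quantity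
`f j u'` is `≤ ε` for all small `u' > 0`, then for every `n` one threshold serves all `j ≤ n`.
[folklore] -/
theorem exists_common_onset {f : ℕ → ℝ → ℝ} {ε : ℝ}
    (h : ∀ j : ℕ, ∃ δT : ℝ, 0 < δT ∧ ∀ u' : ℝ, 0 < u' → u' ≤ δT → f j u' ≤ ε) (n : ℕ) :
    ∃ δT : ℝ, 0 < δT ∧ ∀ j ≤ n, ∀ u' : ℝ, 0 < u' → u' ≤ δT → f j u' ≤ ε := by
  induction n with
  | zero =>
    obtain ⟨δT, hδT, hf⟩ := h 0
    exact ⟨δT, hδT, fun j hj u' hu' hle => by rw [Nat.le_zero.1 hj]; exact hf u' hu' hle⟩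
  | succ n ih =>
    obtain ⟨δ₁, hδ₁, h₁⟩ := ih
    obtain ⟨δ₂, hδ₂, h₂⟩ := h (n + 1)
    refine ⟨min δ₁ δ₂, lt_min hδ₁ hδ₂, fun j hj u' hu' hle => ?_⟩
    rcases Nat.of_le_succ hj with hj' | rfl
    · exact h₁ j hj' u' hu' (hle.trans (min_le_left _ _))
    · exact h₂ u' hu' (hle.trans (min_le_right _ _))

/-- **Per-level power-law rate ⟹ uniform rate.**  Abstract form: `p δ₀ j u`, `q δ₀ j u'` are two
families of real vectors on finite level-`j` index types (the `ℤ²` and `𝕋` coordinate laws),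
`TV δ₀ j u u' = ½ Σ_M |p − q|` and `Dw σ δ₀ K u u' = Σ_{j ≤ K} 2^{-σ j} TV δ₀ j u u'`.  If there
is a common limit `π δ₀ j` with `½ Σ |p δ₀ j u − π δ₀ j| ≤ A·2^{γ j}·(u/δ₀)^α` for `0 < u ≤ δ₀`
and `½ Σ |q δ₀ j u' − π δ₀ j| → 0` as `u' → 0⁺`, then with `σ = γ + α`, `κ = α`,
`C = max 1 ((A+1)(1 − 2^{-α})⁻¹)`: `Dw_K(u,u') ≤ C·2^{-κ K}` for all `0 < u ≤ δ₀/(C 2^K)` and all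
`u'` below a threshold `δ_T(δ₀, K)`. [folklore] -/
theorem uniformRate_of_levelRate {ι : ℕ → Type*} [∀ j, Fintype (ι j)]
    {p : ℝ → (j : ℕ) → ℝ → ι j → ℝ} {q : ℝ → (j : ℕ) → ℝ → ι j → ℝ}
    {TV : ℝ → ℕ → ℝ → ℝ → ℝ} {Dw : ℝ → ℝ → ℕ → ℝ → ℝ → ℝ}
    (hTV : ∀ δ₀ j u u', TV δ₀ j u u' = (1 / 2 : ℝ) * ∑ M, |p δ₀ j u M - q δ₀ j u' M|)
    (hDw : ∀ σ δ₀ K u u', Dw σ δ₀ K u u' =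
      ∑ j ∈ Finset.range (K + 1), (2 : ℝ) ^ (-(σ * (j : ℝ))) * TV δ₀ j u u')
    (h : ∃ α A γ : ℝ, 0 < α ∧ 0 ≤ A ∧ 0 ≤ γ ∧ ∃ π : ℝ → (j : ℕ) → ι j → ℝ,
      (∀ δ₀ : ℝ, 0 < δ₀ → ∀ (j : ℕ) (u : ℝ), 0 < u → u ≤ δ₀ →
        (1 / 2 : ℝ) * ∑ M, |p δ₀ j u M - π δ₀ j M| ≤
          A * (2 : ℝ) ^ (γ * (j : ℝ)) * (u / δ₀) ^ α) ∧
      (∀ δ₀ : ℝ, 0 < δ₀ → ∀ (j : ℕ) (ε : ℝ), 0 < ε → ∃ δT : ℝ, 0 < δT ∧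
        ∀ u' : ℝ, 0 < u' → u' ≤ δT → (1 / 2 : ℝ) * ∑ M, |q δ₀ j u' M - π δ₀ j M| ≤ ε)) :
    ∃ σ C κ : ℝ, 0 < σ ∧ 0 < C ∧ 0 < κ ∧ ∀ δ₀ : ℝ, 0 < δ₀ → ∀ K : ℕ, ∃ δT : ℝ, 0 < δT ∧
      ∀ u u' : ℝ, 0 < u → u ≤ δ₀ / (C * 2 ^ K) → 0 < u' → u' ≤ δT →
        Dw σ δ₀ K u u' ≤ C * (2 : ℝ) ^ (-(κ * (K : ℝ))) := by
  obtain ⟨α, A, γ, hα, hA, hγ, π, hZ, hT⟩ := h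
  -- the geometric bound `B = (1 − 2^{-α})⁻¹` on the total weight at rate `α`
  obtain ⟨B, hB⟩ : ∃ B : ℝ, B = (1 - (2 : ℝ) ^ (-α))⁻¹ := ⟨_, rfl⟩
  obtain ⟨C, hC⟩ : ∃ C : ℝ, C = max 1 ((A + 1) * B) := ⟨_, rfl⟩
  have hC1 : 1 ≤ C := by rw [hC]; exact le_max_left _ _
  have hC0 : 0 < C := one_pos.trans_le hC1
  have hCAB : (A + 1) * B ≤ C := by rw [hC]; exact le_max_right _ _
  refine ⟨γ + α, C, α, add_pos_of_nonneg_of_pos hγ hα, hC0, hα, fun δ₀ hδ₀ K => ?_⟩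
  -- accuracy `ε = 2^{-α K}` on the `𝕋` side, common to all levels `j ≤ K`
  obtain ⟨ε, hε⟩ : ∃ ε : ℝ, ε = (2 : ℝ) ^ (-(α * (K : ℝ))) := ⟨_, rfl⟩
  have hε0 : 0 < ε := by rw [hε]; exact Real.rpow_pos_of_pos two_pos _
  obtain ⟨δT, hδT, hTK⟩ := exists_common_onset
    (f := fun j u' => (1 / 2 : ℝ) * ∑ M, |q δ₀ j u' M - π δ₀ j M|)
    (fun j => hT δ₀ hδ₀ j ε hε0) K
  refine ⟨δT, hδT, fun u u' hu hule hu' hu'le => ?_⟩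
  -- the `ℤ²` rate at the onset: `u ≤ δ₀ / 2^K`, so `(u/δ₀)^α ≤ 2^{-α K} = ε`
  have h2K : (0 : ℝ) < 2 ^ K := by positivity
  have hule' : u ≤ δ₀ / 2 ^ K := hule.trans (by
    apply div_le_div_of_nonneg_left hδ₀.le h2K
    calc (2 : ℝ) ^ K = 1 * 2 ^ K := (one_mul _).symm
      _ ≤ C * 2 ^ K := by gcongr)
  have huδ₀ : u ≤ δ₀ := hule'.trans (div_le_self hδ₀.le (one_le_pow₀ one_le_two))
  have hquot : u / δ₀ ≤ (2 : ℝ) ^ (-(K : ℝ)) := by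
    rw [div_le_iff₀ hδ₀, Real.rpow_neg zero_le_two, Real.rpow_natCast]
    calc u ≤ δ₀ / 2 ^ K := hule'
      _ = (2 ^ K)⁻¹ * δ₀ := by ring
  have hrate : (u / δ₀) ^ α ≤ ε := by
    rw [hε]
    calc (u / δ₀) ^ α ≤ ((2 : ℝ) ^ (-(K : ℝ))) ^ α :=
          Real.rpow_le_rpow (div_nonneg hu.le hδ₀.le) hquot hα.le
      _ = (2 : ℝ) ^ (-(α * (K : ℝ))) := by
          rw [← Real.rpow_mul zero_le_two]; congr 1; ring
  -- per level: `TV_j ≤ (A+1) 2^{γ j} ε`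
  have hlevel : ∀ j ≤ K, TV δ₀ j u u' ≤ (A + 1) * (2 : ℝ) ^ (γ * (j : ℝ)) * ε := by
    intro j hj
    have hw1 : (1 : ℝ) ≤ (2 : ℝ) ^ (γ * (j : ℝ)) :=
      Real.one_le_rpow one_le_two (mul_nonneg hγ (Nat.cast_nonneg j))
    have hsplit : TV δ₀ j u u' ≤ (1 / 2 : ℝ) * ∑ M, |p δ₀ j u M - π δ₀ j M| +
        (1 / 2 : ℝ) * ∑ M, |q δ₀ j u' M - π δ₀ j M| := by
      rw [hTV, ← mul_add, ← Finset.sum_add_distrib]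
      gcongr with M
      calc |p δ₀ j u M - q δ₀ j u' M| ≤ |p δ₀ j u M - π δ₀ j M| + |π δ₀ j M - q δ₀ j u' M| :=
            abs_sub_le _ _ _
        _ = |p δ₀ j u M - π δ₀ j M| + |q δ₀ j u' M - π δ₀ j M| := by
            rw [abs_sub_comm (π δ₀ j M) (q δ₀ j u' M)]
    have hZj := hZ δ₀ hδ₀ j u hu huδ₀
    have hTj := hTK j hj u' hu' hu'le
    calc TV δ₀ j u u' ≤ _ := hsplit
      _ ≤ A * (2 : ℝ) ^ (γ * (j : ℝ)) * (u / δ₀) ^ α + ε := add_le_add hZj hTj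
      _ ≤ A * (2 : ℝ) ^ (γ * (j : ℝ)) * ε + (2 : ℝ) ^ (γ * (j : ℝ)) * ε :=
          add_le_add (mul_le_mul_of_nonneg_left hrate (by positivity))
            (le_mul_of_one_le_left hε0.le hw1)
      _ = (A + 1) * (2 : ℝ) ^ (γ * (j : ℝ)) * ε := by ring
  -- sum over the levels with the weights `2^{-(γ+α) j}`: a geometric series at rate `α`
  have hterm : ∀ j ∈ Finset.range (K + 1),
      (2 : ℝ) ^ (-((γ + α) * (j : ℝ))) * TV δ₀ j u u' ≤ (A + 1) * ε * multiResWeight α j := by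
    intro j hj
    have hj' : j ≤ K := Nat.lt_succ_iff.1 (Finset.mem_range.1 hj)
    have hw0 : 0 ≤ (2 : ℝ) ^ (-((γ + α) * (j : ℝ))) := Real.rpow_nonneg zero_le_two _
    have hexp : -((γ + α) * (j : ℝ)) + γ * (j : ℝ) = -(α * (j : ℝ)) := by ring
    calc (2 : ℝ) ^ (-((γ + α) * (j : ℝ))) * TV δ₀ j u u'
        ≤ (2 : ℝ) ^ (-((γ + α) * (j : ℝ))) * ((A + 1) * (2 : ℝ) ^ (γ * (j : ℝ)) * ε) :=
          mul_le_mul_of_nonneg_left (hlevel j hj') hw0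
      _ = (A + 1) * ε * ((2 : ℝ) ^ (-((γ + α) * (j : ℝ))) * (2 : ℝ) ^ (γ * (j : ℝ))) := by ring
      _ = (A + 1) * ε * multiResWeight α j := by
          rw [← Real.rpow_add two_pos, hexp]
          rfl
  rw [hDw]
  calc ∑ j ∈ Finset.range (K + 1), (2 : ℝ) ^ (-((γ + α) * (j : ℝ))) * TV δ₀ j u u'
      ≤ ∑ j ∈ Finset.range (K + 1), (A + 1) * ε * multiResWeight α j := Finset.sum_le_sum hterm
    _ = (A + 1) * ε * ∑ j ∈ Finset.range (K + 1), multiResWeight α j := by rw [Finset.mul_sum]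
    _ ≤ (A + 1) * ε * B := by
        rw [hB]
        exact mul_le_mul_of_nonneg_left (sum_multiResWeight_le hα K) (by positivity)
    _ = (A + 1) * B * ε := by ring
    _ ≤ C * ε := mul_le_mul_of_nonneg_right hCAB hε0.le
    _ = C * (2 : ℝ) ^ (-(α * (K : ℝ))) := by rw [hε]

end GluingContractionOfRate

/-- **`GluingContraction` from a uniform power-law merging rate, with `θ = 0`.**  In the route's own
(inlined) vocabulary: if for some `σ, C, κ > 0` the multiresolution discrepancy satisfies
`Dw_K(u,u') ≤ C·2^{-κK}` for every window `δ₀`, depth `K`, `ℤ²`-mesh `0 < u ≤ δ₀/(C 2^K)` and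
`𝕋`-mesh `0 < u' ≤ δ_T(δ₀,K)`, then the crux `GluingContraction` holds — with contraction factor
`θ = 0`, step `m = 1`, radius `ρ = 2C`: clause (A) is its own slack, clause (B) holds on the whole
onset window.  (So the statement's renormalisation reading is not load-bearing; conversely the crux
only gives back plain merging, `ContractionGivesMerging`.)  Registered sub-goal of crux
stmt-CriticalPhenomena-8580. [folklore] -/
theorem GluingContraction_of_uniformRate : (let PZ := Literature.Probability.Percolation.bondPercolation (Literature.Probability.LatticeModels.zdGraph 2) Literature.Probability.Percolation.half; let PT := Literature.Probability.LatticeModels.triSitePercolation Literature.Probability.Percolation.half; let Sq : ℝ → Set ℂ := fun δ₀ => {z : ℂ | 0 < z.re ∧ z.re < δ₀ ∧ 0 < z.im ∧ z.im < δ₀}; let seg : (δ₀ : ℝ) → (j : ℕ) → Fin 4 × Fin (2 ^ j) → Set ℂ := fun δ₀ j a => {z : ℂ | (a.1 = 0 ∧ z.im = 0 ∧ δ₀ * ((a.2 : ℕ) : ℝ) / 2 ^ j ≤ z.re ∧ z.re ≤ δ₀ * (((a.2 : ℕ) : ℝ) + 1) / 2 ^ j) ∨ (a.1 = 1 ∧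 z.re = δ₀ ∧ δ₀ * ((a.2 : ℕ) : ℝ) / 2 ^ j ≤ z.im ∧ z.im ≤ δ₀ * (((a.2 : ℕ) : ℝ) + 1) / 2 ^ j) ∨ (a.1 = 2 ∧ z.im = δ₀ ∧ δ₀ * ((a.2 : ℕ) : ℝ) / 2 ^ j ≤ z.re ∧ z.re ≤ δ₀ * (((a.2 : ℕ) : ℝ) + 1) / 2 ^ j) ∨ (a.1 = 3 ∧ z.re = 0 ∧ δ₀ * ((a.2 : ℕ) : ℝ) / 2 ^ j ≤ z.im ∧ z.im ≤ δ₀ * (((a.2 : ℕ) : ℝ) + 1) / 2 ^ j)}; let EZ : (δ₀ : ℝ) → (j : ℕ) → ℝ → ((Fin 4 × Fin (2 ^ j)) → (Fin 4 × Fin (2 ^ j)) → Bool) → Set (Literature.Probability.Percolation.BondConfig (Literature.Probability.LatticeModels.Site 2)) := fun δ₀ j u M => {ω | ∀ a b, ω ∈ Literature.Probability.Percolation.discreteCrossing (Sq δ₀) u (seg δ₀ j a) (seg δ₀ j b) ↔ M a b = true}; let ET : (δ₀ : ℝ) → (j : ℕ) → ℝ → ((Fin 4 × Fin (2 ^ j))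 → (Fin 4 × Fin (2 ^ j)) → Bool) → Set (Literature.Probability.Percolation.SiteConfig (Literature.Probability.LatticeModels.Site 2)) := fun δ₀ j u M => {ω | ∀ a b, ω ∈ Literature.Probability.LatticeModels.triCrossing (Sq δ₀) u (seg δ₀ j a) (seg δ₀ j b) ↔ M a b = true}; let TV : ℝ → ℕ → ℝ → ℝ → ℝ := fun δ₀ j u u' => (1 / 2 : ℝ) * ∑ M : (Fin 4 × Fin (2 ^ j)) → (Fin 4 × Fin (2 ^ j)) → Bool, |PZ.real (EZ δ₀ j u M) - PT.real (ET δ₀ j u' M)|; let Dw : ℝ → ℝ → ℕ → ℝ → ℝ → ℝ := fun σ δ₀ K u u' => ∑ j ∈ Finset.range (K + 1), (2 : ℝ) ^ (-(σ * (j : ℝ))) * TV δ₀ j u u'; ∃ σ C κ : ℝ, 0 < σ ∧ 0 < C ∧ 0 < κ ∧ ∀ δ₀ : ℝ, 0 < δ₀ → ∀ K : ℕ, ∃ δT : ℝ, 0 < δT ∧ ∀ u u' : ℝ, 0 < u → u ≤ δ₀ / (C * 2 ^ K) → 0 < u' → u' ≤ δT → Dw σ δ₀ K u u' ≤ C * (2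 : ℝ) ^ (-(κ * (K : ℝ)))) → Summit.CriticalPhenomena.CardyFormulaZ2.Theses.CardyGluingRDE.GluingContraction :=
  fun h => GluingContractionOfRate.contraction_of_uniformRate h

/-- **`GluingContraction` from a per-level power-law rate of convergence of the `ℤ²` laws to the
`𝕋` scaling limit.**  In the route's vocabulary (`PZ.real (EZ δ₀ j u M)` = bond-`ℤ²` mass of the
segment-matrix `M` at resolution `j`, mesh `u`; `PT.real (ET δ₀ j u' M)` = site-`𝕋` mass): if there
are `α > 0`, `A, γ ≥ 0` and limit vectors `π δ₀ j` with
`½ Σ_M |P_ℤ²(E^Z_M) − π_M| ≤ A·2^{γ j}·(u/δ₀)^α` for `0 < u ≤ δ₀` (POWER-LAW RATE on `ℤ²`) and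
`½ Σ_M |P_𝕋(E^T_M) − π_M| → 0` as `u' → 0⁺` (mere convergence on `𝕋`, e.g. Camia–Newman), then
`GluingContraction` holds (via `GluingContraction_of_uniformRate` with `σ = γ + α`, `κ = α`,
`C = max 1 ((A+1)(1 − 2^{-α})⁻¹)`, `θ = 0`).  Registered sub-goal of crux
stmt-CriticalPhenomena-8580. [folklore] -/
theorem GluingContraction_of_levelRate : (let PZ := Literature.Probability.Percolation.bondPercolation (Literature.Probability.LatticeModels.zdGraph 2) Literature.Probability.Percolation.half; let PT := Literature.Probability.LatticeModels.triSitePercolation Literature.Probability.Percolation.half; let Sq : ℝ → Set ℂ := fun δ₀ => {z : ℂ | 0 < z.re ∧ z.re < δ₀ ∧ 0 < z.im ∧ z.im < δ₀}; let seg : (δ₀ : ℝ) → (j : ℕ) → Fin 4 × Fin (2 ^ j) → Set ℂ := fun δ₀ j a => {z : ℂ | (a.1 = 0 ∧ z.im = 0 ∧ δ₀ * ((a.2 : ℕ) : ℝ) / 2 ^ j ≤ z.re ∧ z.re ≤ δ₀ * (((a.2 : ℕ) : ℝ) + 1) / 2 ^ j) ∨ (a.1 = 1 ∧ z.re = δ₀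 ∧ δ₀ * ((a.2 : ℕ) : ℝ) / 2 ^ j ≤ z.im ∧ z.im ≤ δ₀ * (((a.2 : ℕ) : ℝ) + 1) / 2 ^ j) ∨ (a.1 = 2 ∧ z.im = δ₀ ∧ δ₀ * ((a.2 : ℕ) : ℝ) / 2 ^ j ≤ z.re ∧ z.re ≤ δ₀ * (((a.2 : ℕ) : ℝ) + 1) / 2 ^ j) ∨ (a.1 = 3 ∧ z.re = 0 ∧ δ₀ * ((a.2 : ℕ) : ℝ) / 2 ^ j ≤ z.im ∧ z.im ≤ δ₀ * (((a.2 : ℕ) : ℝ) + 1) / 2 ^ j)}; let EZ : (δ₀ : ℝ) → (j : ℕ) → ℝ → ((Fin 4 × Fin (2 ^ j)) → (Fin 4 × Fin (2 ^ j)) → Bool) → Set (Literature.Probability.Percolation.BondConfig (Literature.Probability.LatticeModels.Site 2)) := fun δ₀ j u M => {ω | ∀ a b, ω ∈ Literature.Probability.Percolation.discreteCrossing (Sq δ₀) u (seg δ₀ j a) (seg δ₀ j b) ↔ M a b = true}; let ET : (δ₀ : ℝ) → (j : ℕ) → ℝ → ((Fin 4 × Fin (2 ^ j)) → (Fin 4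 × Fin (2 ^ j)) → Bool) → Set (Literature.Probability.Percolation.SiteConfig (Literature.Probability.LatticeModels.Site 2)) := fun δ₀ j u M => {ω | ∀ a b, ω ∈ Literature.Probability.LatticeModels.triCrossing (Sq δ₀) u (seg δ₀ j a) (seg δ₀ j b) ↔ M a b = true}; ∃ α A γ : ℝ, 0 < α ∧ 0 ≤ A ∧ 0 ≤ γ ∧ ∃ π : (δ₀ : ℝ) → (j : ℕ) → ((Fin 4 × Fin (2 ^ j)) → (Fin 4 × Fin (2 ^ j)) → Bool) → ℝ, (∀ δ₀ : ℝ, 0 < δ₀ → ∀ (j : ℕ) (u : ℝ), 0 < u → u ≤ δ₀ → (1 / 2 : ℝ) * ∑ M : (Fin 4 × Fin (2 ^ j)) → (Fin 4 × Fin (2 ^ j)) → Bool, |PZ.real (EZ δ₀ j u M) - π δ₀ j M| ≤ A * (2 : ℝ) ^ (γ * (j : ℝ)) * (u / δ₀) ^ α) ∧ (∀ δ₀ : ℝ, 0 < δ₀ → ∀ (j : ℕ) (ε : ℝ), 0 < ε → ∃ δT : ℝ, 0 < δT ∧ ∀ u' : ℝ, 0 < u' → u' ≤ δT → (1 / 2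 : ℝ) * ∑ M : (Fin 4 × Fin (2 ^ j)) → (Fin 4 × Fin (2 ^ j)) → Bool, |PT.real (ET δ₀ j u' M) - π δ₀ j M| ≤ ε)) → Summit.CriticalPhenomena.CardyFormulaZ2.Theses.CardyGluingRDE.GluingContraction := by
  intro h
  refine GluingContraction_of_uniformRate ?_
  exact GluingContractionOfRate.uniformRate_of_levelRate (fun _ _ _ _ => rfl)
    (fun _ _ _ _ _ => rfl) h

end Summit.CriticalPhenomena.CardyFormulaZ2.Theorems
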